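/-
Copyright (c) 2026. All rights reserved.
Released under Apache 2.0 license as described in the file LICENSE.
Authors: abc-iut cell, F fact-proving wave seat abc-iut-f-073 (tranche 73, exact criterion for F-0319).
-/
import Literature.AnabelianGeometry.AbsoluteAnabelian.AbsTopIII.BiAnabelianIncompatibilityKernelShadow

/-!
# [AbsTopIII] Cor 3.7 (iv), first incompatibility — the coherent lax system of shadow 2-cells
# "identity cells + one `ι_×` cell" on `𝒟†_{≤3}`

S. Mochizuki, *Topics in absolute anabelian geometry III* [MochizukiAbsTopIII2015] (kurims manuscript
`paper:url-5493eb38cbb7`; journal pagination not held), Cor 3.7 (iii)/(iv) p. 88, Def 3.5 (ii) p. 75,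
§0 p. 26 (saturated sets of co-verticial pairs).

Step 2 of the second half of the EXACT CRITERION for F-0319 `IncompatibleStmt` (step 1:
`BiAnabelianIncompatibilityKernelShadow.lean`; step 3: `…KernelFamily.lean`).  On the shadow
`kerShadow ζ` of `𝒟†_{≤3}`:

* `KerCell ζ p q τ` — "the co-verticial pair `(p, q)` carries the shadow 2-cell `τ`": `eq` — a pair
  into an admissible vertex with EQUAL shadows and the same number of `λ^{×pf}`-edges carries
  `eqToHom` (all would-be core pairs `([pr_{⋎+1}], [pr_⋎]∘[log_𝒳])`, all reflexive pairs); `times` — a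
  pair `([λ^×]∘[γ₁], [λ^{×pf}]∘[γ₂])` with `γ₁, γ₂` paths to `□` carries `ι_×` whiskered by the shadow
  of `γ₂` (the type-(1)/(2) pairs of `𝔖†_log` and their composites with core pairs);
* `KerCell.unique` (a pair carries at most one 2-cell — the `pfNum` invariant), `KerCell.comp`,
  `.precomp`, `.postcomp` (the laws of Def 3.5 (ii) on the shadow; `times ∘ eq` uses
  `kerShadow_shP_lvBox_eq`, two `times` cells never compose), `kerRel_isSaturated`;
* `kerCells ζ : (kerShadow ζ).LaxCells` — abc-iut-f-074's coherent lax system (boundary set "carries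
  a cell", 2-cells `kerσ` chosen by uniqueness, admissible vertices `kerGood`).

All 2-cell identities are reduced by `exact` to small generic `eqToHom` lemmas (the shadow categories
are bundled `Cat` objects, so rewriting inside components is avoided).  Nothing here bears on
[IUTchIII] Cor. 3.12; no claim of the paper is asserted.
-/

set_option autoImplicit false

namespace Literature.AnabelianGeometry.AbsoluteAnabelian.AbsTopIII

open CategoryTheory Quiver DiagramOfCategories

universe u

namespace BiAnabelianSetting

variable {X E N : Type u} [Category.{u} X] [Category.{u} E] [Category.{u} N]
  (𝔖 : BiAnabelianSetting X E N)

/-! ## The cells, their uniqueness and their laws -/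

section Cells

variable (ζ : 𝟭 X ≅ 𝔖.log)

/-- The 2-cell bookkeeping of `times ∘ eq`: moving an `eqToHom` across a left whiskering along
EQUAL functors. [folklore] -/
private theorem comp_cell_aux {A : Type*} [Category A] {B : Type*} [Category B] {C : Type*}
    [Category C] {F G : A ⥤ B} (hFG : F = G) {L₁ L₂ : B ⥤ C} (ι : L₁ ⟶ L₂) {P : A ⥤ C}
    (hs : P = F ⋙ L₁) (hs' : F ⋙ L₂ = G ⋙ L₂) (H : P = G ⋙ L₁) :
    (eqToHom hs ≫ Functor.whiskerLeft F ι) ≫ eqToHom hs' = eqToHom H ≫ Functor.whiskerLeft G ι := by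
  subst hFG hs
  simp

/-- `eqToHom` bookkeeping for the whiskering law of a `times` cell: components of a natural
transformation at equal objects, conjugated. [folklore] -/
private theorem app_conj_aux {B : Type*} [Category B] {C : Type*} [Category C] {L₁ L₂ : B ⥤ C}
    (ι : L₁ ⟶ L₂) {Z₁ Z₂ : B} (hZ : Z₁ = Z₂) {S T : C} (a : S = L₁.obj Z₁) (b₁ : S = T)
    (b₂ : T = L₁.obj Z₂) (b₃ : L₂.obj Z₂ = L₂.obj Z₁) :
    eqToHom a ≫ ι.app Z₁ = eqToHom b₁ ≫ (eqToHom b₂ ≫ ι.app Z₂) ≫ eqToHom b₃ := by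
  subst hZ b₁ b₂
  simp

/-- `ι_×` as a 2-cell between the shadows of the observation edges `λ^×`, `λ^{×pf}` (the same natural
transformation, typed over the shadow categories). [cite: MochizukiAbsTopIII2015, Cor 3.7 (iii) p.88] -/
def kerIota : ((𝔖.kerShadow ζ).she eLamTimes.{u} ⟶ (𝔖.kerShadow ζ).she eLamPf.{u}) := 𝔖.iotaTimes

/-- `kerIota` is `ι_×` componentwise. [cite: MochizukiAbsTopIII2015, Cor 3.7 (iii) p.88] -/
@[simp] theorem kerIota_app (x : X) : (𝔖.kerIota ζ).app x = 𝔖.iotaTimes.app x := rfl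

/-- **The cells.**  `eq`: a pair into an admissible vertex with EQUAL shadows and the same number of
`λ^{×pf}`-edges carries the identity 2-cell (`eqToHom`) — this covers the would-be core pairs
`([pr_{⋎+1}], [pr_⋎]∘[log_𝒳])` and all reflexive pairs; `times`: the pair
`([λ^×]∘[γ₁], [λ^{×pf}]∘[γ₂])` (`γ₁, γ₂` paths to `□` with equal shadows followed by `λ^×`) carries
`ι_×` whiskered by the shadow of `γ₂` — this covers the type-(1) and type-(2) pairs of `𝔖†_log` and
their composites with core pairs. [cite: MochizukiAbsTopIII2015, Cor 3.7 (iv) p.88] -/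
inductive KerCell : ∀ {a b : logObsShape.{u}.Vertex} (p q : Path a b),
    ((𝔖.kerShadow ζ).shP p ⟶ (𝔖.kerShadow ζ).shP q) → Prop
  | eq {a b : logObsShape.{u}.Vertex} {p q : Path a b} (hb : kerGood b)
      (hs : (𝔖.kerShadow ζ).shP p = (𝔖.kerShadow ζ).shP q) (hn : pfNum p = pfNum q) :
      KerCell p q (eqToHom hs)
  | times {a : logObsShape.{u}.Vertex} (p₀ q₀ : Path a lvBox.{u})
      (hs : (𝔖.kerShadow ζ).shP (p₀.cons eLamTimes) = (𝔖.kerShadow ζ).shP (q₀.cons eLamTimes)) :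
      KerCell (p₀.cons eLamTimes) (q₀.cons eLamPf)
        (eqToHom hs ≫ Functor.whiskerLeft ((𝔖.kerShadow ζ).shP q₀) (𝔖.kerIota ζ))

variable {𝔖 ζ}

namespace KerCell

/-- Cells end at admissible vertices. [cite: MochizukiAbsTopIII2015, Cor 3.7 (iv) p.88] -/
theorem good {a b : logObsShape.{u}.Vertex} {p q : Path a b}
    {τ : (𝔖.kerShadow ζ).shP p ⟶ (𝔖.kerShadow ζ).shP q} (h : 𝔖.KerCell ζ p q τ) : kerGood b := by
  cases h with
  | eq hb _ _ => exact hb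
  | times => trivial

/-- Transport of a cell along an equality of 2-cells. [cite: MochizukiAbsTopIII2015, Definition 3.5 (ii) p.75] -/
theorem congr {a b : logObsShape.{u}.Vertex} {p q : Path a b}
    {τ τ' : (𝔖.kerShadow ζ).shP p ⟶ (𝔖.kerShadow ζ).shP q} (h : 𝔖.KerCell ζ p q τ) (e : τ = τ') :
    𝔖.KerCell ζ p q τ' :=
  e ▸ h

/-- A `times` cell changes the number of `λ^{×pf}`-edges, an `eq` cell does not. [cite: MochizukiAbsTopIII2015, Cor 3.7 (iv) p.88] -/
theorem pfNum_times {a : logObsShape.{u}.Vertex} (p₀ q₀ : Path a lvBox.{u}) :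
    pfNum (p₀.cons eLamTimes) ≠ pfNum (q₀.cons eLamPf) := by
  rw [pfNum_cons, pfNum_cons, pfNum_eq_zero_of_ne_lvObs p₀ lvBox_ne_lvObs,
    pfNum_eq_zero_of_ne_lvObs q₀ lvBox_ne_lvObs, edgePf_eLamTimes, edgePf_eLamPf]
  decide

/-- **A pair carries at most one cell 2-cell.** [cite: MochizukiAbsTopIII2015, Cor 3.7 (iv) p.88] -/
theorem unique {a b : logObsShape.{u}.Vertex} {p q : Path a b}
    {τ τ' : (𝔖.kerShadow ζ).shP p ⟶ (𝔖.kerShadow ζ).shP q} (h : 𝔖.KerCell ζ p q τ)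
    (h' : 𝔖.KerCell ζ p q τ') : τ = τ' := by
  cases h with
  | eq hb hs hn =>
    cases h' with
    | eq => rfl
    | times p₀ q₀ hs' => exact absurd hn (pfNum_times p₀ q₀)
  | times p₀ q₀ hs =>
    cases h' with
    | eq hb hs' hn => exact absurd hn (pfNum_times p₀ q₀)
    | times => rfl

/-- The cell of a reflexive pair is the identity. [cite: MochizukiAbsTopIII2015, Definition 3.5 (ii) p.75] -/
theorem eq_id {a b : logObsShape.{u}.Vertex} {p : Path a b}
    {τ : (𝔖.kerShadow ζ).shP p ⟶ (𝔖.kerShadow ζ).shP p} (h : 𝔖.KerCell ζ p p τ) : τ = 𝟙 _ := by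
  cases h with
  | eq hb hs hn => exact eqToHom_refl _ _

/-- A path into `𝒩` with as many `λ^{×pf}`-edges as `[λ^×]∘[γ]` ends with `λ^×`.
[cite: MochizukiAbsTopIII2015, Cor 3.7 (iii) p.88] -/
theorem exists_eq_cons_eLamTimes {a : logObsShape.{u}.Vertex} (p : Path a lvObs.{u})
    (q₀ : Path a lvBox.{u}) (hn : pfNum p = pfNum (q₀.cons eLamTimes)) :
    ∃ p₀ : Path a lvBox.{u}, p = p₀.cons eLamTimes := by
  obtain ⟨p₀, b, rfl⟩ := exists_eq_cons_of_path_lvObs p (ne_lvObs_of_path_lvBox q₀)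
  cases b with
  | true => exact ⟨p₀, rfl⟩
  | false =>
    rw [pfNum_cons, pfNum_cons, pfNum_eq_zero_of_ne_lvObs p₀ lvBox_ne_lvObs,
      pfNum_eq_zero_of_ne_lvObs q₀ lvBox_ne_lvObs, edgePf_up, edgePf_eLamTimes] at hn
    simp at hn

/-- A path into `𝒩` with as many `λ^{×pf}`-edges as `[λ^{×pf}]∘[γ]` ends with `λ^{×pf}`.
[cite: MochizukiAbsTopIII2015, Cor 3.7 (iii) p.88] -/
theorem exists_eq_cons_eLamPf {a : logObsShape.{u}.Vertex} (p : Path a lvObs.{u})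
    (q₀ : Path a lvBox.{u}) (hn : pfNum (q₀.cons eLamPf) = pfNum p) :
    ∃ p₀ : Path a lvBox.{u}, p = p₀.cons eLamPf := by
  obtain ⟨p₀, b, rfl⟩ := exists_eq_cons_of_path_lvObs p (ne_lvObs_of_path_lvBox q₀)
  cases b with
  | false => exact ⟨p₀, rfl⟩
  | true =>
    rw [pfNum_cons, pfNum_cons, pfNum_eq_zero_of_ne_lvObs p₀ lvBox_ne_lvObs,
      pfNum_eq_zero_of_ne_lvObs q₀ lvBox_ne_lvObs, edgePf_up, edgePf_eLamPf] at hn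
    simp at hn

/-- **Cells compose** (the composition law of Def 3.5 (ii) on the shadow): `eq ∘ eq = eq`,
`eq ∘ times = times`, `times ∘ eq = times` (through `kerShadow_shP_lvBox_eq`); two `times` cells
never compose. [cite: MochizukiAbsTopIII2015, Definition 3.5 (ii) p.75] -/
theorem comp {a b : logObsShape.{u}.Vertex} {p q r : Path a b}
    {τ₁ : (𝔖.kerShadow ζ).shP p ⟶ (𝔖.kerShadow ζ).shP q}
    {τ₂ : (𝔖.kerShadow ζ).shP q ⟶ (𝔖.kerShadow ζ).shP r}
    (h₁ : 𝔖.KerCell ζ p q τ₁) (h₂ : 𝔖.KerCell ζ q r τ₂) : 𝔖.KerCell ζ p r (τ₁ ≫ τ₂) := by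
  cases h₁ with
  | eq hb hs hn =>
    cases h₂ with
    | eq hb' hs' hn' =>
      rw [eqToHom_trans]
      exact .eq hb' (hs.trans hs') (hn.trans hn')
    | times q₀ r₀ hs' =>
      obtain ⟨p₀, rfl⟩ := exists_eq_cons_eLamTimes p q₀ hn
      rw [← Category.assoc, eqToHom_trans]
      exact .times p₀ r₀ (hs.trans hs')
  | times p₀ q₀ hs =>
    cases h₂ with
    | eq hb' hs' hn' =>
      obtain ⟨r₀, rfl⟩ := exists_eq_cons_eLamPf r q₀ hn'
      have E := 𝔖.kerShadow_shP_lvBox_eq ζ q₀ r₀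
      have h₁' : (𝔖.kerShadow ζ).shP (q₀.cons eLamTimes) = (𝔖.kerShadow ζ).shP (r₀.cons eLamTimes) := by
        rw [PseudoShadow.shP_cons, PseudoShadow.shP_cons, E]
      exact (KerCell.times p₀ r₀ (hs.trans h₁')).congr
        (comp_cell_aux E (𝔖.kerIota ζ) hs hs' (hs.trans h₁')).symm

/-- Cells are stable under pre-composition with a path. [cite: MochizukiAbsTopIII2015, Definition 3.5 (ii) p.75] -/
theorem precomp {a b c : logObsShape.{u}.Vertex} {p q : Path a b}
    {τ : (𝔖.kerShadow ζ).shP p ⟶ (𝔖.kerShadow ζ).shP q} (h : 𝔖.KerCell ζ p q τ) (r : Path c a) :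
    ∃ τ', 𝔖.KerCell ζ (r.comp p) (r.comp q) τ' := by
  cases h with
  | eq hb hs hn =>
    exact ⟨_, .eq hb (by rw [PseudoShadow.shP_comp, PseudoShadow.shP_comp, hs])
      (by rw [pfNum_comp, pfNum_comp, hn])⟩
  | times p₀ q₀ hs =>
    refine ⟨_, .times (r.comp p₀) (r.comp q₀) ?_⟩
    rw [← Path.comp_cons, ← Path.comp_cons, PseudoShadow.shP_comp, PseudoShadow.shP_comp, hs]

/-- Cells are stable under post-composition with a path. [cite: MochizukiAbsTopIII2015, Definition 3.5 (ii) p.75] -/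
theorem postcomp {a b c : logObsShape.{u}.Vertex} {p q : Path a b}
    {τ : (𝔖.kerShadow ζ).shP p ⟶ (𝔖.kerShadow ζ).shP q} (h : 𝔖.KerCell ζ p q τ) (r : Path b c) :
    ∃ τ', 𝔖.KerCell ζ (p.comp r) (q.comp r) τ' := by
  cases h with
  | eq hb hs hn =>
    exact ⟨_, .eq (kerGood_of_path r hb) (by rw [PseudoShadow.shP_comp, PseudoShadow.shP_comp, hs])
      (by rw [pfNum_comp, pfNum_comp, hn])⟩
  | times p₀ q₀ hs =>
    obtain ⟨rfl, hr⟩ := path_from_lvObs r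
    cases hr
    exact ⟨_, .times p₀ q₀ hs⟩

end KerCell

/-- **The boundary set "carries a cell" is saturated** (§0 p. 26 (a), (c), (d), (e)).
[cite: MochizukiAbsTopIII2015, Section 0 p.26] -/
theorem kerRel_isSaturated :
    IsSaturated (fun ⦃a b : logObsShape.{u}.Vertex⦄ (p q : Path a b) => ∃ τ, 𝔖.KerCell ζ p q τ) where
  refl_left := by
    rintro a b p q ⟨τ, hc⟩
    exact ⟨_, .eq hc.good rfl rfl⟩
  refl_right := by
    rintro a b p q ⟨τ, hc⟩
    exact ⟨_, .eq hc.good rfl rfl⟩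
  trans := by
    rintro a b p q r ⟨τ₁, h₁⟩ ⟨τ₂, h₂⟩
    exact ⟨_, h₁.comp h₂⟩
  precomp := by
    rintro a b c p q ⟨τ, hc⟩ r
    exact hc.precomp r
  postcomp := by
    rintro a b c p q ⟨τ, hc⟩ r
    exact hc.postcomp r

/-- The 2-cell of a pair of the boundary set: THE cell 2-cell it carries (unique by
`KerCell.unique`). [cite: MochizukiAbsTopIII2015, Definition 3.5 (ii) p.75] -/
noncomputable def kerσ ⦃a b : logObsShape.{u}.Vertex⦄ ⦃p q : Path a b⦄
    (h : ∃ τ, 𝔖.KerCell ζ p q τ) : ((𝔖.kerShadow ζ).shP p ⟶ (𝔖.kerShadow ζ).shP q) :=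
  h.choose

/-- `kerσ h` is a cell 2-cell. [cite: MochizukiAbsTopIII2015, Definition 3.5 (ii) p.75] -/
theorem kerσ_spec {a b : logObsShape.{u}.Vertex} {p q : Path a b} (h : ∃ τ, 𝔖.KerCell ζ p q τ) :
    𝔖.KerCell ζ p q (kerσ h) :=
  h.choose_spec

/-- `kerσ h` is any cell 2-cell of the pair. [cite: MochizukiAbsTopIII2015, Definition 3.5 (ii) p.75] -/
theorem kerσ_eq {a b : logObsShape.{u}.Vertex} {p q : Path a b} (h : ∃ τ, 𝔖.KerCell ζ p q τ)
    {τ : (𝔖.kerShadow ζ).shP p ⟶ (𝔖.kerShadow ζ).shP q} (hc : 𝔖.KerCell ζ p q τ) : kerσ h = τ :=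
  (kerσ_spec h).unique hc

variable (𝔖 ζ)

/-- **The coherent lax system of shadow 2-cells on `kerShadow ζ`** (abc-iut-f-074's `LaxCells`):
boundary set "carries a cell", 2-cells the cell 2-cells, admissible vertices `kerGood`; the
identity / composition / whiskering laws of Def 3.5 (ii) hold ON THE SHADOW.
[cite: MochizukiAbsTopIII2015, Definition 3.5 (ii) p.75] -/
noncomputable def kerCells : (𝔖.kerShadow ζ).LaxCells where
  R := fun ⦃a b : logObsShape.{u}.Vertex⦄ (p q : Path a b) => ∃ τ, 𝔖.KerCell ζ p q τ
  isSaturated := 𝔖.kerRel_isSaturated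
  good := kerGood
  good_of := fun ⦃_ _⦄ ⦃_ _⦄ h => (kerσ_spec h).good
  σ := fun ⦃_ _⦄ ⦃_ _⦄ h => kerσ h
  σ_refl := fun ⦃_ _⦄ ⦃_⦄ h => (kerσ_spec h).eq_id
  σ_trans := fun ⦃_ _⦄ ⦃_ _ _⦄ h₁ h₂ => kerσ_eq _ ((kerσ_spec h₁).comp (kerσ_spec h₂))
  σ_whisker_app := by
    intro a b c d p q h r₁ r₂ y
    obtain ⟨τ, hc⟩ := id h
    rw [kerσ_eq h hc]
    cases hc with
    | eq hb hs hn =>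
      have hc' : 𝔖.KerCell ζ (r₁.comp (p.comp r₂)) (r₁.comp (q.comp r₂)) (eqToHom (by
          rw [PseudoShadow.shP_comp, PseudoShadow.shP_comp, PseudoShadow.shP_comp,
            PseudoShadow.shP_comp, hs])) :=
        .eq (kerGood_of_path r₂ hb) _
          (by rw [pfNum_comp, pfNum_comp, pfNum_comp, pfNum_comp, hn])
      rw [kerσ_eq _ hc']
      simp only [eqToHom_app, eqToHom_map, eqToHom_trans]
    | times p₀ q₀ hs =>
      obtain ⟨rfl, hr⟩ := path_from_lvObs r₂
      cases hr
      have hs' : (𝔖.kerShadow ζ).shP ((r₁.comp p₀).cons eLamTimes) =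
          (𝔖.kerShadow ζ).shP ((r₁.comp q₀).cons eLamTimes) := by
        rw [← Path.comp_cons, ← Path.comp_cons, PseudoShadow.shP_comp, PseudoShadow.shP_comp, hs]
      have hc' : 𝔖.KerCell ζ (r₁.comp ((p₀.cons eLamTimes).comp Path.nil))
          (r₁.comp ((q₀.cons eLamPf).comp Path.nil))
          (eqToHom hs' ≫ Functor.whiskerLeft ((𝔖.kerShadow ζ).shP (r₁.comp q₀)) (𝔖.kerIota ζ)) :=
        .times (r₁.comp p₀) (r₁.comp q₀) hs'
      rw [kerσ_eq _ hc']
      simp only [NatTrans.comp_app, eqToHom_app, Functor.whiskerLeft_app, PseudoShadow.shP_nil,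
        Functor.id_map]
      exact app_conj_aux (𝔖.kerIota ζ) ((𝔖.kerShadow ζ).shP_comp_obj r₁ q₀ y) _ _ _ _

end Cells

end BiAnabelianSetting

end Literature.AnabelianGeometry.AbsoluteAnabelian.AbsTopIII
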